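import Summits.AtomisticToContinuum.Crystallization.Theorems.ChartedZeroExcessLayeredLatticeLiouvilleZZZYRCXRWA

/-!
# ZZZYRCXRW — LETTER-SYMMETRY (S₃) TRANSPORT of the kernel data, PER LETTER SEQUENCE, with the ENVELOPE tables
(binder 26636, line (D); lens-2 g101; critic r1907 (B3) lemma (L3); over ZZZYRCXRWA's affine realisation `symSite/symChord/symKey/unsymKey`)

* §3 ★★ `kernelSlabSoundAtP_sym` — the EXACT per-sequence transport: data sound at `ℓ` on `Far` ⇒ the mapped data sound at `ℓ'` on `Far` with
  the tables re-keyed by `unsymKey g σ₀ ℓ` (any affine realisation `σ₀² = 1`, `3·g(ℓ m) + ℓ' m = σ₀·ℓ m + κ`).  Data AND re-keying depend on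
  `ℓ` at the piece's end layers, which may lie OUTSIDE the letter window — hence no fixed-data transport of the type contract (r1902 (C)(i)).
* §4 removes the dependence in the TABLES: where the `g`-value of a layer is pinned (in-window letters) the key shift is known, elsewhere
  `g ∈ {g₀, g₁}`, so the four-candidate maximum ★ `envTab σ₀ pin g₀ g₁ T` majorises the re-keyed table for every admissible sequence
  (`le_envTab`) ⇒ ★★ `kernelSlabSoundAtP_sym_env`.  The price of the envelope is paid in the K-file numerics only on keys with an unpinned end
  layer (memo S3-TRANSPORT-g101.md §4: 13.2–15.0 % at the worst cell), never in certification.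
* §4b the algebra of parts AT ONE SEQUENCE (what hand-1's transported half-word units are joined with, ZZZYRCXRWD): `kernelSlabSoundAtP_append`
  (union on disjoint far-layer predicates: data `++`, tables `+`), ★ `kernelSlabSoundAtP_cover` (far layers within `M` of the centre covered,
  `hi < 6(M+1)²` ⇒ the full contract at that sequence; only `6Δm² ≤ 9|e|²` is used, no box lemma), `kernelSlabSoundFE_of_parts`.
* §5 ★★★ `kernelSlabSoundFE_sym` — the TYPE-level transport (existential data): the contract of `wd` gives the contract of `wd.map f` with the
  envelope tables pinned by `wd`'s own letters (`pinW`).  One kernel certification serves the whole S₃-orbit of a type (×6 with §6's two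
  generators; ×2 more with the reversal ZZZYRCXRX).
* §6 the generators: `sym_rotation` (`r ↦ r+1`: `g = [· = 2]`, `σ₀ = 1`, `κ = 1`, inverse = double rotation) and `sym_transposition`
  (`r ↦ −r`: `g = −[· ≠ 0]`, `σ₀ = −1`, `κ = 0`, involutive) discharge every letter-level hypothesis of §5 by `decide`; toys at `H₀ = 2`.

Imports ZZZYRCXRWA; 0 sorry. [folklore]
-/

namespace Summit.AtomisticToContinuum.Crystallization.Theorems.ChartedZeroExcessLayeredLatticeLiouville

section Sym

variable {g : ℤ → ℤ} {σ₀ : ℤ} {ℓ : ℤ → ℤ} {H₀ : ℕ} {ℓ' : ℤ → ℤ} {κ : ℤ}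

/-! ### §3 ★ the exact per-sequence transport -/

/-- ★★ **LETTER-SYMMETRY TRANSPORT, PER SEQUENCE**: kernel data sound at `ℓ` on `Far` ⇒ the mapped data are sound at `ℓ'` on `Far` with the
tables re-keyed by `unsymKey` — for any affine realisation `(g, σ₀, κ)` of `ℓ ↦ ℓ'` (`σ₀² = 1`, `3·g(ℓ m) + ℓ' m = σ₀·ℓ m + κ`). [g101] -/
theorem kernelSlabSoundAtP_sym {R E : ℕ} {Far : ℤ → Prop} {lo hi P9max : ℤ} {cd : List ChordDatum} {TRz TNz : ℤ × ℤ × ℤ × ℤ → ℤ}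
    (hσ2 : σ₀ * σ₀ = 1) (hcoh : ∀ m, 3 * g (ℓ m) + ℓ' m = σ₀ * ℓ m + κ) (h : KernelSlabSoundAtP H₀ R ℓ Far lo hi P9max E cd TRz TNz) :
    KernelSlabSoundAtP H₀ R ℓ' Far lo hi P9max E (cd.map (symChord g σ₀ ℓ H₀)) (fun k => TRz (unsymKey g σ₀ ℓ k))
      fun k => TNz (unsymKey g σ₀ ℓ k) := by
  obtain ⟨hV, hnd, hcomp, hT⟩ := h
  refine ⟨?_, ?_, ?_, fun k => ?_⟩
  · intro c' hc'
    obtain ⟨c, hc, rfl⟩ := List.mem_map.1 hc'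
    obtain ⟨hcb, hfar, hpw, hpc⟩ := hV c hc
    refine ⟨isCenterBased_sym hcb, hfar, piecesWithin_sym hpw, fun hlo hhi i hi => ?_⟩
    rw [symChord_fst, n9F_sym hσ2 hcoh] at hlo hhi
    rw [chordNp_sym] at hi
    rw [chordPiece_sym, n9F_sym hσ2 hcoh]
    exact hpc hlo hhi i hi
  · rw [map_fst_symChord]
    exact hnd.map (symPair_injective hσ2)
  · intro x hx hfar hlo hhi
    rw [← symPair_unsymPair (g := g) (ℓ := ℓ) (H₀ := H₀) hσ2 x, n9F_sym hσ2 hcoh] at hlo hhi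
    obtain ⟨c, hc, hc1⟩ := hcomp (unsymPair g σ₀ ℓ H₀ x) (isCenterBased_unsym hx) hfar hlo hhi
    exact ⟨symChord g σ₀ ℓ H₀ c, List.mem_map.2 ⟨c, hc, rfl⟩, by rw [symChord_fst, hc1, symPair_unsymPair hσ2]⟩
  · rw [thetaR0G_sym hσ2 hcoh, thetaN0G_sym hσ2 hcoh]
    exact hT (unsymKey g σ₀ ℓ k)

/-! ### §4 the envelope tables (no dependence on out-of-window letters) -/

/-- the two candidate `g`-values at layer `m`: the pinned value twice, or `(g₀, g₁)`. [g101] -/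
def gCand (pin : ℤ → Option ℤ) (g₀ g₁ : ℤ) (m : ℤ) : ℤ × ℤ :=
  match pin m with
  | some v => (v, v)
  | none => (g₀, g₁)

/-- the re-keyed table value at key `k` for the `g`-values `u` (start layer) and `v` (end layer). [g101] -/
def symTabAt (σ₀ : ℤ) (T : ℤ × ℤ × ℤ × ℤ → ℤ) (k : ℤ × ℤ × ℤ × ℤ) (u v : ℤ) : ℤ :=
  T (k.1, σ₀ * (k.2.1 - (v - u)), σ₀ * (k.2.2.1 - (v - u)), k.2.2.2)

/-- ★ THE ENVELOPE TABLE: the maximum of the re-keyed table over the (at most four) candidate `g`-value pairs at the key's two layers. [g101] -/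
def envTab (σ₀ : ℤ) (pin : ℤ → Option ℤ) (g₀ g₁ : ℤ) (T : ℤ × ℤ × ℤ × ℤ → ℤ) (k : ℤ × ℤ × ℤ × ℤ) : ℤ :=
  max (max (symTabAt σ₀ T k (gCand pin g₀ g₁ k.1).1 (gCand pin g₀ g₁ (k.1 + k.2.2.2)).1)
        (symTabAt σ₀ T k (gCand pin g₀ g₁ k.1).1 (gCand pin g₀ g₁ (k.1 + k.2.2.2)).2))
    (max (symTabAt σ₀ T k (gCand pin g₀ g₁ k.1).2 (gCand pin g₀ g₁ (k.1 + k.2.2.2)).1)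
        (symTabAt σ₀ T k (gCand pin g₀ g₁ k.1).2 (gCand pin g₀ g₁ (k.1 + k.2.2.2)).2))

/-- the actual `g`-value at a layer is one of the two candidates. [g101] -/
theorem gCand_spec {pin : ℤ → Option ℤ} {g₀ g₁ : ℤ} (hpin : ∀ m v, pin m = some v → g (ℓ m) = v)
    (hg : ∀ m, g (ℓ m) = g₀ ∨ g (ℓ m) = g₁) (m : ℤ) : g (ℓ m) = (gCand pin g₀ g₁ m).1 ∨ g (ℓ m) = (gCand pin g₀ g₁ m).2 := by
  unfold gCand
  cases hp : pin m with
  | none => simpa using hg m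
  | some v => exact Or.inl (by simpa using hpin m v hp)

/-- ★ the envelope majorises the re-keyed table for every sequence respecting the pins and the value set. [g101] -/
theorem le_envTab {pin : ℤ → Option ℤ} {g₀ g₁ : ℤ} (hpin : ∀ m v, pin m = some v → g (ℓ m) = v)
    (hg : ∀ m, g (ℓ m) = g₀ ∨ g (ℓ m) = g₁) (T : ℤ × ℤ × ℤ × ℤ → ℤ) (k : ℤ × ℤ × ℤ × ℤ) :
    T (unsymKey g σ₀ ℓ k) ≤ envTab σ₀ pin g₀ g₁ T k := by
  have e : T (unsymKey g σ₀ ℓ k) = symTabAt σ₀ T k (g (ℓ k.1)) (g (ℓ (k.1 + k.2.2.2))) := rfl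
  rw [e]
  unfold envTab
  rcases gCand_spec hpin hg k.1 with ha | ha <;> rcases gCand_spec hpin hg (k.1 + k.2.2.2) with hb | hb <;> rw [ha, hb]
  · exact le_max_of_le_left (le_max_left _ _)
  · exact le_max_of_le_left (le_max_right _ _)
  · exact le_max_of_le_right (le_max_left _ _)
  · exact le_max_of_le_right (le_max_right _ _)

/-- ★★ TRANSPORT WITH ENVELOPE TABLES: per sequence, the mapped data are sound at `ℓ'` with tables independent of the unpinned letters. [g101] -/
theorem kernelSlabSoundAtP_sym_env {R E : ℕ} {Far : ℤ → Prop} {lo hi P9max : ℤ} {cd : List ChordDatum}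
    {TRz TNz : ℤ × ℤ × ℤ × ℤ → ℤ} {pin : ℤ → Option ℤ} {g₀ g₁ : ℤ} (hσ2 : σ₀ * σ₀ = 1)
    (hcoh : ∀ m, 3 * g (ℓ m) + ℓ' m = σ₀ * ℓ m + κ) (hpin : ∀ m v, pin m = some v → g (ℓ m) = v)
    (hg : ∀ m, g (ℓ m) = g₀ ∨ g (ℓ m) = g₁) (h : KernelSlabSoundAtP H₀ R ℓ Far lo hi P9max E cd TRz TNz) :
    KernelSlabSoundAtP H₀ R ℓ' Far lo hi P9max E (cd.map (symChord g σ₀ ℓ H₀)) (envTab σ₀ pin g₀ g₁ TRz) (envTab σ₀ pin g₀ g₁ TNz) :=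
  kernelSlabSoundAtP_mono (fun k => le_envTab hpin hg TRz k) (fun k => le_envTab hpin hg TNz k) (kernelSlabSoundAtP_sym hσ2 hcoh h)

end Sym

/-! ### §4b the algebra of parts at one sequence: union on disjoint far layers, cover ⇒ full -/

section Parts

variable {H₀ R E : ℕ} {ℓ : ℤ → ℤ} {Far Far₁ Far₂ : ℤ → Prop} {lo hi P9max : ℤ} {cd cd₁ cd₂ : List ChordDatum}
  {TRz TNz TR₁ TN₁ TR₂ TN₂ : ℤ × ℤ × ℤ × ℤ → ℤ}

/-- equivalent far-layer predicates give the same contract. [g101] -/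
theorem kernelSlabSoundAtP_far_iff (hiff : ∀ m, Far m ↔ Far₁ m) (h : KernelSlabSoundAtP H₀ R ℓ Far lo hi P9max E cd TRz TNz) :
    KernelSlabSoundAtP H₀ R ℓ Far₁ lo hi P9max E cd TRz TNz :=
  ⟨fun c hc => ⟨(h.1 c hc).1, (hiff _).1 (h.1 c hc).2.1, (h.1 c hc).2.2⟩, h.2.1,
    fun x hx hf => h.2.2.1 x hx ((hiff _).2 hf), h.2.2.2⟩

/-- ★ UNION AT ONE SEQUENCE: parts on DISJOINT far-layer predicates join (data concatenated, tables added). [g101] -/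
theorem kernelSlabSoundAtP_append (h₁ : KernelSlabSoundAtP H₀ R ℓ Far₁ lo hi P9max E cd₁ TR₁ TN₁)
    (h₂ : KernelSlabSoundAtP H₀ R ℓ Far₂ lo hi P9max E cd₂ TR₂ TN₂) (hdis : ∀ m, Far₁ m → ¬ Far₂ m) :
    KernelSlabSoundAtP H₀ R ℓ (fun m => Far₁ m ∨ Far₂ m) lo hi P9max E (cd₁ ++ cd₂) (fun k => TR₁ k + TR₂ k)
      fun k => TN₁ k + TN₂ k := by
  obtain ⟨V₁, N₁, C₁, T₁⟩ := h₁
  obtain ⟨V₂, N₂, C₂, T₂⟩ := h₂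
  refine ⟨fun c hc => ?_, ?_, fun x hxb hfar hxlo hxhi => ?_, fun k => ?_⟩
  · rcases List.mem_append.mp hc with hc | hc
    · obtain ⟨h1, h2, h3, h4⟩ := V₁ c hc
      exact ⟨h1, Or.inl h2, h3, h4⟩
    · obtain ⟨h1, h2, h3, h4⟩ := V₂ c hc
      exact ⟨h1, Or.inr h2, h3, h4⟩
  · rw [List.map_append]
    refine List.nodup_append.mpr ⟨N₁, N₂, fun p hp q hq hpq => ?_⟩
    obtain ⟨c₁, hc₁, rfl⟩ := List.mem_map.mp hp
    obtain ⟨c₂, hc₂, rfl⟩ := List.mem_map.mp hq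
    have h12 : c₁.1.2.2 = c₂.1.2.2 := by rw [hpq]
    exact hdis _ (V₁ c₁ hc₁).2.1 (h12 ▸ (V₂ c₂ hc₂).2.1)
  · rcases hfar with h | h
    · obtain ⟨c, hc, hcx⟩ := C₁ x hxb h hxlo hxhi
      exact ⟨c, List.mem_append_left _ hc, hcx⟩
    · obtain ⟨c, hc, hcx⟩ := C₂ x hxb h hxlo hxhi
      exact ⟨c, List.mem_append_right _ hc, hcx⟩
  · obtain ⟨eR, eN⟩ := thetaG_append ℓ lo hi cd₁ cd₂ k
    rw [eR, eN, Int.cast_add, Int.cast_add, add_div, add_div]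
    exact ⟨add_le_add (T₁ k).1 (T₂ k).1, add_le_add (T₁ k).2 (T₂ k).2⟩

/-- `9|e|² ≥ 6Δm²`: the in-plane form `a² + ab + b²` is nonnegative. [folklore] -/
theorem six_mul_sq_le_n9F (ℓ : ℤ → ℤ) (x : (Cell 2 × ℤ) × (Cell 2 × ℤ)) : 6 * (x.2.2 - x.1.2) ^ 2 ≤ n9F ℓ x := by
  simp only [n9F]
  nlinarith [sq_nonneg (2 * (refF0 ℓ x.2 - refF0 ℓ x.1) + (refF1 ℓ x.2 - refF1 ℓ x.1)), sq_nonneg (refF1 ℓ x.2 - refF1 ℓ x.1)]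

/-- an in-range pair (`n9 ≤ hi < 6(M+1)²`) spans at most `M` layers. [folklore] -/
theorem abs_layers_le_of_n9F_le {x : (Cell 2 × ℤ) × (Cell 2 × ℤ)} {M : ℕ} (hx : n9F ℓ x ≤ hi) (hMb : hi < 6 * ((M : ℤ) + 1) ^ 2) :
    |x.2.2 - x.1.2| ≤ M := by
  have h6 := six_mul_sq_le_n9F ℓ x
  have hlt : (x.2.2 - x.1.2) ^ 2 < ((M : ℤ) + 1) ^ 2 := by nlinarith
  exact Int.lt_add_one_iff.mp (abs_lt_of_sq_lt_sq hlt (by positivity))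

/-- ★ A COVERING PART IS THE FULL CONTRACT at that sequence: far layers within `M` of the centre all in `Far`, `hi < 6(M+1)²`. [g101] -/
theorem kernelSlabSoundAtP_cover {M : ℕ} (hMb : hi < 6 * ((M : ℤ) + 1) ^ 2) (hcov : ∀ m : ℤ, |m - H₀| ≤ M → Far m)
    (h : KernelSlabSoundAtP H₀ R ℓ Far lo hi P9max E cd TRz TNz) : KernelSlabSoundAtP H₀ R ℓ (fun _ => True) lo hi P9max E cd TRz TNz :=
  ⟨fun c hc => ⟨(h.1 c hc).1, trivial, (h.1 c hc).2.2⟩, h.2.1,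
    fun x hxb _ hxlo hxhi => h.2.2.1 x hxb (hcov _ (by rw [← hxb.2]; exact abs_layers_le_of_n9F_le hxhi hMb)) hxlo hxhi, h.2.2.2⟩

/-- ★ THE TYPE CONTRACT FROM PARTS: per agreeing sequence, some covering part ⇒ `KernelSlabSoundFE`. [g101] -/
theorem kernelSlabSoundFE_of_parts {M : ℕ} {wd : List ℤ} (hMb : hi < 6 * ((M : ℤ) + 1) ^ 2)
    (h : ∀ ℓ, IsLetterSeq ℓ → AgreesOnWindow H₀ wd ℓ → ∃ (Far : ℤ → Prop) (cd : List ChordDatum),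
      (∀ m : ℤ, |m - H₀| ≤ M → Far m) ∧ KernelSlabSoundAtP H₀ R ℓ Far lo hi P9max E cd TRz TNz) :
    KernelSlabSoundFE H₀ R wd lo hi P9max E TRz TNz := fun ℓ hℓ hag => by
  obtain ⟨Far, cd, hcov, hP⟩ := h ℓ hℓ hag
  exact ⟨cd, kernelSlabSoundAtP_top (kernelSlabSoundAtP_cover hMb hcov hP)⟩

end Parts

/-! ### §5 ★ the type-level transport with existential data -/

/-- the pins of a window word: `g` of the word's letter on the window layers `0 … 2H₀`, free outside. [g101] -/
def pinW (H₀ : ℕ) (g : ℤ → ℤ) (wd : List ℤ) (m : ℤ) : Option ℤ := if 0 ≤ m ∧ m ≤ 2 * (H₀ : ℤ) then some (g (regW wd m)) else none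

/-- the periodic letter of a mapped word on the window. [g101] -/
theorem regW_map_of_lt {wd : List ℤ} (f : ℤ → ℤ) {j : ℤ} (h0 : 0 ≤ j) (hj : j < (wd.length : ℤ)) :
    regW (wd.map f) j = f (regW wd j) := by
  unfold regW
  rw [List.length_map]
  have hn : (j % (wd.length : ℤ)).toNat < wd.length := by rw [Int.emod_eq_of_lt h0 hj]; omega
  rw [List.getD_eq_getElem _ _ (by rw [List.length_map]; exact hn), List.getD_eq_getElem _ _ hn, List.getElem_map]

/-- ★★★ **S₃ TRANSPORT OF THE TYPE CONTRACT** (existential data, envelope tables): a letter permutation `f` with inverse `f'` on `{0,1,2}` and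
an affine realisation `(g, σ₀, κ)` (`3·g r + f r = σ₀·r + κ`, `g r ∈ {g₀, g₁}` on letters) carries the contract of the window word `wd` to the
contract of `wd.map f`, with the envelope tables pinned by `wd`'s own letters.  One kernel certification serves the whole S₃-orbit of a type. [g101] -/
theorem kernelSlabSoundFE_sym {H₀ R E : ℕ} {lo hi P9max : ℤ} {wd : List ℤ} {TRz TNz : ℤ × ℤ × ℤ × ℤ → ℤ} {f f' g : ℤ → ℤ}
    {σ₀ κ g₀ g₁ : ℤ} (hσ2 : σ₀ * σ₀ = 1) (hcoh : ∀ r, 0 ≤ r → r ≤ 2 → 3 * g r + f r = σ₀ * r + κ)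
    (hg : ∀ r, 0 ≤ r → r ≤ 2 → g r = g₀ ∨ g r = g₁) (hf' : ∀ r, 0 ≤ r → r ≤ 2 → 0 ≤ f' r ∧ f' r ≤ 2)
    (hff' : ∀ r, 0 ≤ r → r ≤ 2 → f (f' r) = r) (hf'f : ∀ r, 0 ≤ r → r ≤ 2 → f' (f r) = r) (hwd : ∀ c ∈ wd, 0 ≤ c ∧ c ≤ 2)
    (hlen : wd.length = 2 * H₀ + 1) (h : KernelSlabSoundFE H₀ R wd lo hi P9max E TRz TNz) :
    KernelSlabSoundFE H₀ R (wd.map f) lo hi P9max E (envTab σ₀ (pinW H₀ g wd) g₀ g₁ TRz) (envTab σ₀ (pinW H₀ g wd) g₀ g₁ TNz) := by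
  intro ℓ'' hℓ'' hag''
  -- the preimage sequence `ℓ := f' ∘ ℓ''` agrees with `wd`
  have hℓ : IsLetterSeq (fun m => f' (ℓ'' m)) := fun m => hf' _ (hℓ'' m).1 (hℓ'' m).2
  have hag : AgreesOnWindow H₀ wd (fun m => f' (ℓ'' m)) := by
    intro j h0 hj
    have hr := regW_bounds hwd j
    show f' (ℓ'' j) = regW wd j
    rw [hag'' j h0 hj, regW_map_of_lt f h0 (by rw [hlen]; push_cast; omega), hf'f _ hr.1 hr.2]
  obtain ⟨cd, hV, hT⟩ := h _ hℓ hag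
  have hcoh' : ∀ m, 3 * g (f' (ℓ'' m)) + ℓ'' m = σ₀ * f' (ℓ'' m) + κ := fun m => by
    have h1 := hcoh (f' (ℓ'' m)) (hℓ m).1 (hℓ m).2
    rwa [hff' _ (hℓ'' m).1 (hℓ'' m).2] at h1
  have hpin : ∀ m v, pinW H₀ g wd m = some v → g (f' (ℓ'' m)) = v := by
    intro m v hm
    unfold pinW at hm
    split_ifs at hm with hc
    · rw [show f' (ℓ'' m) = regW wd m from hag m hc.1 hc.2]
      exact Option.some.inj hm
  have hg' : ∀ m, g (f' (ℓ'' m)) = g₀ ∨ g (f' (ℓ'' m)) = g₁ := fun m => hg _ (hℓ m).1 (hℓ m).2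
  exact ⟨cd.map (symChord g σ₀ (fun m => f' (ℓ'' m)) H₀),
    kernelSlabSoundAtP_top (kernelSlabSoundAtP_sym_env (ℓ' := ℓ'') hσ2 hcoh' hpin hg' (kernelSlabSoundAtP_of_top hV hT))⟩

/-! ### §6 the two generators of S₃ and toys -/

/-- the letter ROTATION `r ↦ r + 1 (mod 3)` is realised by `g = [· = 2]`, `σ₀ = 1`, `κ = 1`; its inverse is the double rotation. [g101] -/
theorem sym_rotation :
    (∀ r : ℤ, 0 ≤ r → r ≤ 2 → 3 * (if r = 2 then (1 : ℤ) else 0) + (r + 1) % 3 = 1 * r + 1) ∧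
      (∀ r : ℤ, 0 ≤ r → r ≤ 2 → (if r = 2 then (1 : ℤ) else 0) = 0 ∨ (if r = 2 then (1 : ℤ) else 0) = 1) ∧
      (∀ r : ℤ, 0 ≤ r → r ≤ 2 → 0 ≤ (r + 2) % 3 ∧ (r + 2) % 3 ≤ 2) ∧
      (∀ r : ℤ, 0 ≤ r → r ≤ 2 → ((r + 2) % 3 + 1) % 3 = r) ∧ ∀ r : ℤ, 0 ≤ r → r ≤ 2 → ((r + 1) % 3 + 2) % 3 = r := by
  refine ⟨fun r h0 h2 => ?_, fun r h0 h2 => ?_, fun r h0 h2 => ?_, fun r h0 h2 => ?_, fun r h0 h2 => ?_⟩ <;>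
    interval_cases r <;> decide

/-- the letter TRANSPOSITION `r ↦ −r (mod 3)` (`B ↔ C`) is realised by `g = −[· ≠ 0]`, `σ₀ = −1`, `κ = 0`; it is its own inverse. [g101] -/
theorem sym_transposition :
    (∀ r : ℤ, 0 ≤ r → r ≤ 2 → 3 * (if r = 0 then (0 : ℤ) else -1) + (3 - r) % 3 = -1 * r + 0) ∧
      (∀ r : ℤ, 0 ≤ r → r ≤ 2 → (if r = 0 then (0 : ℤ) else -1) = 0 ∨ (if r = 0 then (0 : ℤ) else -1) = -1) ∧
      (∀ r : ℤ, 0 ≤ r → r ≤ 2 → 0 ≤ (3 - r) % 3 ∧ (3 - r) % 3 ≤ 2) ∧ ∀ r : ℤ, 0 ≤ r → r ≤ 2 → (3 - (3 - r) % 3) % 3 = r := by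
  refine ⟨fun r h0 h2 => ?_, fun r h0 h2 => ?_, fun r h0 h2 => ?_, fun r h0 h2 => ?_⟩ <;> interval_cases r <;> decide

/-- toy (`H₀ = 2`, rotation, `ℓ ≡ 2` so `g ∘ ℓ ≡ 1`): the key `(1, 2, −1, 3)` is fixed (equal shifts at both layers cancel), and the site
`((4, 7), 1)` maps to itself re-centred: `σ₀γ + (g(ℓ 1) − g(ℓ 2))·(1,1) = γ`. [g101] -/
example : symKey (fun r => if r = 2 then (1 : ℤ) else 0) 1 (fun _ => 2) ((1 : ℤ), (2 : ℤ), (-1 : ℤ), (3 : ℤ)) = (1, 2, -1, 3) ∧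
    symSite (fun r => if r = 2 then (1 : ℤ) else 0) 1 (fun _ => 2) 2 (![4, 7], 1) = (![4, 7], 1) := by
  refine ⟨by decide, Prod.ext (funext fun i => ?_) rfl⟩
  fin_cases i <;> simp [symSite]

/-- toy: with the end layer free (`pin = none` beyond the window `0 … 4`) the envelope of the indicator table of key `(3, 0, 0, 2)` at the keys
`(3, 0, 0, 2)` and `(3, 1, 1, 2)` is `1` (shift `δ ∈ {0, 1}` from the free layer `5`), at `(3, −1, −1, 2)` it is `0`. [g101] -/
example :
    let T : ℤ × ℤ × ℤ × ℤ → ℤ := fun k => if k = (3, 0, 0, 2) then 1 else 0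
    let pin := pinW 2 (fun r => if r = 2 then (1 : ℤ) else 0) [0, 1, 0, 1, 0]
    envTab 1 pin 0 1 T (3, 0, 0, 2) = 1 ∧ envTab 1 pin 0 1 T (3, 1, 1, 2) = 1 ∧ envTab 1 pin 0 1 T (3, -1, -1, 2) = 0 := by
  decide

end Summit.AtomisticToContinuum.Crystallization.Theorems.ChartedZeroExcessLayeredLatticeLiouville
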